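import Summits.AtomisticToContinuum.BoseEinsteinCondensation.Theorems.BECInsertionCorrectorCorrectorClosureTailModesAux
import Literature.MathematicalPhysics.QuantumManyBody.PeriodicBoseGasFourier
import HarnessLib

/-!
# Crux `CorrectorClosure` (stmt-AtomisticToContinuum-12058), line `residue-area-law` —
# stub `stub_firstCorrectorBound`, auxiliary file 1: cell Fourier series of bounded measurable functions

Supports (does not close) stmt-AtomisticToContinuum-12058, route `BECInsertionCorrector`.
`PeriodicBoseGasFourier.lean` transports Mathlib's Fourier theory of `L²((ℝ/ℤ)³)` to the cell
`[0,L)³` for CONTINUOUS functions; the periodised pair potential `v^per` of a bounded measurable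
profile is only bounded measurable, so this file redoes the facts the first-corrector bound needs
for bounded measurable `φ : ℝ³ → ℂ`: Parseval (`hasSum_sq_cellFourierCoeff_of_bound`), the `L²`
convergence of the cubic partial sums (`tendsto_lintegral_sq_partialSum_sub_of_bound`) and the
uniform coefficient bound `‖ĉₙ(φ)‖ ≤ L⁻³∫‖φ‖`; plus, for REAL `φ = U`, the symmetry `ĉ₋ₙ = conj ĉₙ`,
the real form `Re S_K φ = ∑ₙ ((Re ĉₙ) cos(pₙ·y) - (Im ĉₙ) sin(pₙ·y))` of the partial sums, and their
`L²` convergence to `U`. Theorems only; the torus measure of `Mathlib.Analysis.Fourier.AddCircleMulti`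
(Haar probability on `ℝ/ℤ`) is written out explicitly instead of through a local instance.
-/

noncomputable section

open MeasureTheory Filter Set WithLp Complex
open scoped ENNReal NNReal Topology ComplexConjugate

namespace Summit.AtomisticToContinuum.BoseEinsteinCondensation.Theorems.CorrectorClosure.ResidueAreaLaw

open Literature.MathematicalPhysics.QuantumManyBody.BoseGas

variable {L : ℝ}

/-! ### Parseval and `L²` convergence for bounded measurable functions -/

/-- **Parseval on the cell for bounded measurable functions**:
`∑ₙ ‖ĉₙ(φ)‖² = L⁻³ ∫_{[0,L)³} ‖φ‖²`. [folklore] -/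
theorem hasSum_sq_cellFourierCoeff_of_bound (hL : 0 < L) {φ : Space → ℂ} (hφ : Measurable φ)
    {C : ℝ} (hC : ∀ z, ‖φ z‖ ≤ C) :
    HasSum (fun n => ‖cellFourierCoeff L φ n‖ ^ 2) ((L ^ 3)⁻¹ * ∫ x in cell L, ‖φ x‖ ^ 2) := by
  -- adapted from `hasSum_sq_cellFourierCoeff` (PeriodicBoseGasFourier): continuity replaced by a
  -- bound; the torus measure of `AddCircleMulti` is spelled out (no local instance)
  haveI : IsFiniteMeasure (@volume (UnitAddTorus (Fin 3))
      (@MeasureSpace.pi (Fin 3) _ (fun _ => UnitAddCircle) fun _ => instMeasureSpaceUnitAddCircle)) := by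
    show IsFiniteMeasure (Measure.pi fun _ : Fin 3 => (AddCircle.haarAddCircle : Measure UnitAddCircle))
    infer_instance
  have hf : MemLp (torusFun L φ) 2 (@volume (UnitAddTorus (Fin 3))
      (@MeasureSpace.pi (Fin 3) _ (fun _ => UnitAddCircle) fun _ => instMeasureSpaceUnitAddCircle)) :=
    MemLp.of_bound ((hφ.comp (measurable_fromUnitTorus L)).aestronglyMeasurable) C
      (Eventually.of_forall fun _ => hC _)
  have hP := UnitAddTorus.hasSum_sq_mFourierCoeff (hf.toLp _)
  have hcoeff : ∀ n, UnitAddTorus.mFourierCoeff (hf.toLp _ : UnitAddTorus (Fin 3) → ℂ) n =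
      cellFourierCoeff L φ n := fun n =>
    integral_congr_ae (hf.coeFn_toLp.mono fun t ht => by simp only [ht])
  have hnorm : ∫ t, ‖(hf.toLp _ : UnitAddTorus (Fin 3) → ℂ) t‖ ^ 2 ∂(@volume (UnitAddTorus (Fin 3))
      (@MeasureSpace.pi (Fin 3) _ (fun _ => UnitAddCircle) fun _ => instMeasureSpaceUnitAddCircle)) =
      ∫ t, ‖torusFun L φ t‖ ^ 2 ∂(@volume (UnitAddTorus (Fin 3))
      (@MeasureSpace.pi (Fin 3) _ (fun _ => UnitAddCircle) fun _ => instMeasureSpaceUnitAddCircle)) :=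
    integral_congr_ae (hf.coeFn_toLp.mono fun t ht => by simp only [ht])
  simp only [hcoeff, hnorm] at hP
  have htr := integral_fromUnitTorus hL (fun x : Space => ‖φ x‖ ^ 2)
  simp only [smul_eq_mul] at htr
  unfold torusFun at hP
  rwa [htr] at hP

/-- Parseval as a bound on finite sums: `∑_{n ∈ T} ‖ĉₙ(φ)‖² ≤ L⁻³ ∫_{[0,L)³} ‖φ‖²`. [folklore] -/
theorem sum_sq_cellFourierCoeff_le_of_bound (hL : 0 < L) {φ : Space → ℂ} (hφ : Measurable φ)
    {C : ℝ} (hC : ∀ z, ‖φ z‖ ≤ C) (T : Finset (Fin 3 → ℤ)) :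
    ∑ n ∈ T, ‖cellFourierCoeff L φ n‖ ^ 2 ≤ (L ^ 3)⁻¹ * ∫ x in cell L, ‖φ x‖ ^ 2 :=
  sum_le_hasSum T (fun _ _ => sq_nonneg _) (hasSum_sq_cellFourierCoeff_of_bound hL hφ hC)

/-- **`L²` convergence of the cubic partial sums for bounded measurable functions**:
`∫_{[0,L)³} ‖S_K φ - φ‖² → 0`. [folklore] -/
theorem tendsto_lintegral_sq_partialSum_sub_of_bound (hL : 0 < L) {φ : Space → ℂ}
    (hφ : Measurable φ) {C : ℝ} (hC : ∀ z, ‖φ z‖ ≤ C) :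
    Tendsto (fun K => ∫⁻ x in cell L, (‖partialSum L φ K x - φ x‖₊ : ℝ≥0∞) ^ 2) atTop (𝓝 0) := by
  -- adapted from `tendsto_lintegral_sq_partialSum_sub` (PeriodicBoseGasFourier): same proof, with
  -- `MemLp.of_bound` for `memLp_torusFun`, measurability for continuity, explicit torus measure
  haveI : IsFiniteMeasure (@volume (UnitAddTorus (Fin 3))
      (@MeasureSpace.pi (Fin 3) _ (fun _ => UnitAddCircle) fun _ => instMeasureSpaceUnitAddCircle)) := by
    show IsFiniteMeasure (Measure.pi fun _ : Fin 3 => (AddCircle.haarAddCircle : Measure UnitAddCircle))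
    infer_instance
  have hf : MemLp (torusFun L φ) 2 (@volume (UnitAddTorus (Fin 3))
      (@MeasureSpace.pi (Fin 3) _ (fun _ => UnitAddCircle) fun _ => instMeasureSpaceUnitAddCircle)) :=
    MemLp.of_bound ((hφ.comp (measurable_fromUnitTorus L)).aestronglyMeasurable) C
      (Eventually.of_forall fun _ => hC _)
  set F : Lp ℂ 2 (@volume (UnitAddTorus (Fin 3))
      (@MeasureSpace.pi (Fin 3) _ (fun _ => UnitAddCircle) fun _ => instMeasureSpaceUnitAddCircle)) :=
    hf.toLp _ with hFdef
  have hcoeff : ∀ n, UnitAddTorus.mFourierCoeff (F : UnitAddTorus (Fin 3) → ℂ) n =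
      cellFourierCoeff L φ n := fun n =>
    integral_congr_ae (hf.coeFn_toLp.mono fun t ht => by
      show UnitAddTorus.mFourier (-n) t • (F : UnitAddTorus (Fin 3) → ℂ) t = _
      rw [hFdef, ht])
  have hsum := UnitAddTorus.hasSum_mFourier_series_L2 F
  simp only [hcoeff] at hsum
  have hG : Tendsto (fun K : ℕ => ∑ n ∈ Finset.Icc (-(K : Fin 3 → ℤ)) (K : Fin 3 → ℤ),
      cellFourierCoeff L φ n • UnitAddTorus.mFourierLp 2 n) atTop (𝓝 F) :=
    hsum.comp tendsto_Icc_neg_atTop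
  have hnorm : Tendsto (fun K : ℕ => ‖(∑ n ∈ Finset.Icc (-(K : Fin 3 → ℤ)) (K : Fin 3 → ℤ),
      cellFourierCoeff L φ n • UnitAddTorus.mFourierLp 2 n) - F‖ₑ ^ 2) atTop (𝓝 0) := by
    have h1 := (tendsto_iff_norm_sub_tendsto_zero.1 hG)
    have h2 : Tendsto (fun K : ℕ => ‖(∑ n ∈ Finset.Icc (-(K : Fin 3 → ℤ)) (K : Fin 3 → ℤ),
        cellFourierCoeff L φ n • UnitAddTorus.mFourierLp 2 n) - F‖ₑ) atTop (𝓝 0) := by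
      have := ENNReal.tendsto_ofReal h1
      simp only [ENNReal.ofReal_zero] at this
      refine this.congr fun K => ?_
      rw [ofReal_norm]
    have h3 := (ENNReal.continuous_pow 2).continuousAt.tendsto.comp h2
    simpa [Function.comp_def] using h3
  have hid : ∀ K : ℕ, ‖(∑ n ∈ Finset.Icc (-(K : Fin 3 → ℤ)) (K : Fin 3 → ℤ),
      cellFourierCoeff L φ n • UnitAddTorus.mFourierLp 2 n) - F‖ₑ ^ 2 =
      (ENNReal.ofReal L ^ 3)⁻¹ * ∫⁻ x in cell L, (‖partialSum L φ K x - φ x‖₊ : ℝ≥0∞) ^ 2 := by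
    intro K
    rw [← lintegral_nnnorm_sq_eq_enorm_sq]
    have hmeas : Measurable fun x : Space => (‖partialSum L φ K x - φ x‖₊ : ℝ≥0∞) ^ 2 := by
      refine (Measurable.nnnorm ?_).coe_nnreal_ennreal.pow_const _
      refine (Finset.measurable_sum _ fun n _ => ?_).sub hφ
      exact ((contDiff_cellWave L n).continuous.measurable).const_mul _
    rw [← lintegral_fromUnitTorus hL hmeas]
    refine lintegral_congr_ae ?_
    have hae : ∀ n ∈ Finset.Icc (-(K : Fin 3 → ℤ)) (K : Fin 3 → ℤ),
        (fun t => ((cellFourierCoeff L φ n • UnitAddTorus.mFourierLp 2 n :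
          Lp ℂ 2 (@volume (UnitAddTorus (Fin 3)) (@MeasureSpace.pi (Fin 3) _ (fun _ => UnitAddCircle)
            fun _ => instMeasureSpaceUnitAddCircle))) : UnitAddTorus (Fin 3) → ℂ) t)
          =ᵐ[@volume (UnitAddTorus (Fin 3)) (@MeasureSpace.pi (Fin 3) _ (fun _ => UnitAddCircle)
            fun _ => instMeasureSpaceUnitAddCircle)]
        fun t => cellFourierCoeff L φ n * UnitAddTorus.mFourier n t := by
      intro n _
      filter_upwards [Lp.coeFn_smul (cellFourierCoeff L φ n) (UnitAddTorus.mFourierLp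
        (d := Fin 3) 2 n), UnitAddTorus.coeFn_mFourierLp (d := Fin 3) 2 n] with t h1 h2
      rw [h1, Pi.smul_apply, h2, smul_eq_mul]
    filter_upwards [Lp.coeFn_sub (∑ n ∈ Finset.Icc (-(K : Fin 3 → ℤ)) (K : Fin 3 → ℤ),
        cellFourierCoeff L φ n • UnitAddTorus.mFourierLp 2 n) F,
      Lp.coeFn_finsetSum (Finset.Icc (-(K : Fin 3 → ℤ)) (K : Fin 3 → ℤ))
        (fun n => cellFourierCoeff L φ n • UnitAddTorus.mFourierLp (d := Fin 3) 2 n), hf.coeFn_toLp,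
      (ae_ball_iff (Finset.Icc (-(K : Fin 3 → ℤ)) (K : Fin 3 → ℤ)).countable_toSet).2 hae]
      with t h1 h2 h3 h4
    rw [h1, Pi.sub_apply, h2, Finset.sum_apply, h3]
    simp only [partialSum, torusFun, cellWave, toUnitTorus_fromUnitTorus hL.ne']
    rw [Finset.sum_congr rfl fun n hn => h4 n hn]
  simp only [hid] at hnorm
  have hL3 : (ENNReal.ofReal L ^ 3) ≠ 0 := pow_ne_zero _ (by simpa using hL)
  have hL3' : (ENNReal.ofReal L ^ 3) ≠ ⊤ := ENNReal.pow_ne_top ENNReal.ofReal_ne_top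
  have := ENNReal.Tendsto.const_mul hnorm (Or.inr hL3') (a := ENNReal.ofReal L ^ 3)
  simp only [mul_zero] at this
  refine this.congr fun K => ?_
  rw [← mul_assoc, ENNReal.mul_inv_cancel hL3 hL3', one_mul]

/-! ### Coefficient bounds and symmetries -/

/-- **Uniform coefficient bound**: `‖ĉₙ(φ)‖ ≤ L⁻³ ∫_{[0,L)³} ‖φ‖`. [folklore] -/
theorem norm_cellFourierCoeff_le (hL : 0 < L) (φ : Space → ℂ) (n : Fin 3 → ℤ) :
    ‖cellFourierCoeff L φ n‖ ≤ (L ^ 3)⁻¹ * ∫ x in cell L, ‖φ x‖ := by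
  rw [cellFourierCoeff_eq_integral hL, norm_smul, Real.norm_eq_abs,
    abs_of_pos (by positivity)]
  refine mul_le_mul_of_nonneg_left ?_ (by positivity)
  refine (norm_integral_le_integral_norm _).trans (le_of_eq ?_)
  refine integral_congr_ae (Eventually.of_forall fun x => ?_)
  simp only [norm_mul, RCLike.norm_conj, norm_cellWave, one_mul]

/-- **Conjugation symmetry for real functions**: `ĉ₋ₙ(φ) = conj ĉₙ(φ)` if `φ = U` is real-valued.
[folklore] -/
theorem cellFourierCoeff_neg_of_real (hL : 0 < L) (U : Space → ℝ) (n : Fin 3 → ℤ) :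
    cellFourierCoeff L (fun z => (U z : ℂ)) (-n) = conj (cellFourierCoeff L (fun z => (U z : ℂ)) n) := by
  rw [cellFourierCoeff_eq_integral hL, cellFourierCoeff_eq_integral hL, Complex.real_smul,
    Complex.real_smul, map_mul, Complex.conj_ofReal, ← integral_conj]
  congr 1
  refine integral_congr_ae (Eventually.of_forall fun x => ?_)
  simp only [map_mul, Complex.conj_ofReal, conj_cellWave, neg_neg]

/-- **Real form of one term of the Fourier series**:
`Re(ĉ eₙ(y)) = (Re ĉ) cos(pₙ·y) - (Im ĉ) sin(pₙ·y)`. [folklore] -/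
theorem re_mul_cellWave (L : ℝ) (c : ℂ) (n : Fin 3 → ℤ) (y : Space) :
    (c * cellWave L n y).re =
      c.re * Real.cos (2 * Real.pi / L * ∑ i, (n i : ℝ) * y i) -
        c.im * Real.sin (2 * Real.pi / L * ∑ i, (n i : ℝ) * y i) := by
  rw [Complex.mul_re, HealingScaleKacInsertion.cellWave_re_eq_cos,
    HealingScaleKacInsertion.cellWave_im_eq_sin]

/-- **The mean coefficient of a real function**: `Re ĉ₀(φ) = L⁻³ ∫_{[0,L)³} U` for `φ = U` real.
[folklore] -/
theorem re_cellFourierCoeff_zero_of_real (hL : 0 < L) (U : Space → ℝ) :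
    (cellFourierCoeff L (fun z => (U z : ℂ)) 0).re = (L ^ 3)⁻¹ * ∫ x in cell L, U x := by
  rw [cellFourierCoeff_zero hL, Complex.real_smul, Complex.mul_re, Complex.ofReal_re,
    Complex.ofReal_im, zero_mul, sub_zero, integral_complex_ofReal, Complex.ofReal_re]

/-! ### The real part of the cubic partial sums of a real function -/

/-- **Real form of the cubic partial sums**: for `φ = U` real,
`Re S_K φ (y) = ∑_{n ∈ {-K,…,K}³} ((Re ĉₙ) cos(pₙ·y) - (Im ĉₙ) sin(pₙ·y))`. [folklore] -/
theorem re_partialSum_eq_sum (L : ℝ) (U : Space → ℝ) (K : ℕ) (y : Space) :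
    (partialSum L (fun z => (U z : ℂ)) K y).re =
      ∑ n ∈ Finset.Icc (-(K : Fin 3 → ℤ)) (K : Fin 3 → ℤ),
        ((cellFourierCoeff L (fun z => (U z : ℂ)) n).re *
            Real.cos (2 * Real.pi / L * ∑ i, (n i : ℝ) * y i) -
          (cellFourierCoeff L (fun z => (U z : ℂ)) n).im *
            Real.sin (2 * Real.pi / L * ∑ i, (n i : ℝ) * y i)) := by
  rw [partialSum, Complex.re_sum]
  exact Finset.sum_congr rfl fun n _ => re_mul_cellWave L _ n y

/-- The real parts of the partial sums are continuous. [folklore] -/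
theorem continuous_re_partialSum (L : ℝ) (φ : Space → ℂ) (K : ℕ) :
    Continuous fun y => (partialSum L φ K y).re :=
  Complex.continuous_re.comp (contDiff_partialSum L φ K).continuous

/-- The real parts of the partial sums are `Lℤ³`-periodic. [folklore] -/
theorem re_partialSum_periodic (hL : L ≠ 0) (φ : Space → ℂ) (K : ℕ) (y : Space) (k : Fin 3) :
    (partialSum L φ K (y + EuclideanSpace.single k L)).re = (partialSum L φ K y).re := by
  rw [partialSum_periodic hL]

/-- **`L²` convergence of the real partial sums of a bounded measurable real function**:
`∫_{[0,L)³} ‖U - Re S_K φ‖² → 0` for `φ = U` (`|Re w| ≤ |w|`). [folklore] -/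
theorem tendsto_lintegral_sq_sub_re_partialSum (hL : 0 < L) {U : Space → ℝ} (hU : Measurable U)
    {C : ℝ} (hC : ∀ z, |U z| ≤ C) :
    Tendsto (fun K => ∫⁻ y in cell L,
      ‖U y - (partialSum L (fun z => (U z : ℂ)) K y).re‖ₑ ^ 2) atTop (𝓝 0) := by
  have hφ : Measurable fun z => (U z : ℂ) := Complex.measurable_ofReal.comp hU
  have hCφ : ∀ z, ‖((U z : ℂ))‖ ≤ C := fun z => by rw [Complex.norm_real, Real.norm_eq_abs]; exact hC z
  have h := tendsto_lintegral_sq_partialSum_sub_of_bound hL hφ hCφ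
  refine tendsto_of_tendsto_of_tendsto_of_le_of_le tendsto_const_nhds h (fun _ => bot_le)
    fun K => ?_
  refine lintegral_mono fun y => ?_
  have hre : U y - (partialSum L (fun z => (U z : ℂ)) K y).re =
      -(partialSum L (fun z => (U z : ℂ)) K y - (U y : ℂ)).re := by
    rw [Complex.sub_re, Complex.ofReal_re]; ring
  have hle : ‖U y - (partialSum L (fun z => (U z : ℂ)) K y).re‖₊ ≤
      ‖partialSum L (fun z => (U z : ℂ)) K y - (U y : ℂ)‖₊ := by
    rw [← NNReal.coe_le_coe, coe_nnnorm, coe_nnnorm, hre, norm_neg, Real.norm_eq_abs]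
    exact Complex.abs_re_le_norm _
  rw [enorm_eq_nnnorm]
  exact pow_le_pow_left' (ENNReal.coe_le_coe.2 hle) 2

end Summit.AtomisticToContinuum.BoseEinsteinCondensation.Theorems.CorrectorClosure.ResidueAreaLaw

end
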